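import Literature.Computability.ImplicitComplexity.SoftTypeAssignmentLeftmost
import HarnessLib

/-!
# Counted reduction sequences of `Λ₊`

A two-line utility shared by the polynomial bound on leftmost evaluations
(`SoftTypeAssignmentPolyBound.lean`) and the completeness of the machine `STA.KAM`: the counted
reflexive–transitive closure `STA.RelN R n M N` ("`N` is reached from `M` by exactly `n` steps of
`R`") and its comparison with `Relation.ReflTransGen`. Folklore.

## References

* [GaboardiMarionRonchidellarocca2008] GMR08, Lemma 5.7 (counting reduction steps).
-/

namespace Literature.Computability.ImplicitComplexity

namespace STA

/-- `RelN R n M N`: `N` is reached from `M` by exactly `n` steps of `R`. [folklore] -/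
inductive RelN (R : Term → Term → Prop) : ℕ → Term → Term → Prop
  | refl (M : Term) : RelN R 0 M M
  | tail {n : ℕ} {M N P : Term} (h : RelN R n M N) (hs : R N P) : RelN R (n + 1) M P

/-- Counted closure implies closure. [folklore] -/
theorem RelN.reflTransGen {R : Term → Term → Prop} {n : ℕ} {M N : Term} (h : RelN R n M N) :
    Relation.ReflTransGen R M N := by
  induction h with
  | refl => exact Relation.ReflTransGen.refl
  | tail _ hs ih => exact ih.tail hs

/-- Closure implies counted closure for some count. [folklore] -/
theorem RelN.of_reflTransGen {R : Term → Term → Prop} {M N : Term} (h : Relation.ReflTransGen R M N) :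
    ∃ n, RelN R n M N := by
  induction h with
  | refl => exact ⟨0, RelN.refl M⟩
  | tail _ hs ih =>
    obtain ⟨n, hn⟩ := ih
    exact ⟨n + 1, hn.tail hs⟩

/-- Splitting off the first step of a counted sequence. [folklore] -/
theorem RelN.head_split {R : Term → Term → Prop} {n : ℕ} {M N : Term} (h : RelN R (n + 1) M N) :
    ∃ P, R M P ∧ RelN R n P N := by
  induction n generalizing N with
  | zero =>
    cases h with
    | tail h0 hs =>
      cases h0
      exact ⟨N, hs, RelN.refl N⟩
  | succ n ih =>
    cases h with
    | tail h0 hs =>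
      obtain ⟨P, hP, hrest⟩ := ih h0
      exact ⟨P, hP, hrest.tail hs⟩

end STA

end Literature.Computability.ImplicitComplexity
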